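import Literature.IUT.HodgeTheaters.PuncturedEllipticCoveringsCuspTransport
import Literature.AnabelianGeometry.AbsoluteAnabelian.FundamentalExtensionRestriction
import HarnessLib

/-!
# [IUTchI] §1: the cusps of `X̲` as cuspidal data on the extension `Π_X̲ ↠ G_k` — MERGE ADAPTER to layer L4

Mochizuki, *Inter-universal Teichmüller theory I*, kurims manuscript (May 2020), §1, p. 37 ([IUTchI] §1
p.37) [claim: Mochizuki2012, status: disputed]: "`X_K`" [here `X̲`] "a hyperbolic curve … with
arithmetic fundamental group `Π_X̲`", its cusps and "the decomposition groups of cusps" (p. 39: "the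
decomposition groups of `ε⁰`, `ε′`, `ε″` in `Π_X̲` may be recovered as the decomposition groups of cusps
[cf. [AbsTopI], Lemma 4.5 …]").

MERGE ADAPTER (definitions; no `Prop` facts, no instances, no notation) paying the
"INTERFACE DATA (TODO-merge:abc-iut-L4-t1)" debt of abc-iut-L5-t1's FROZEN `PuncturedEllipticData`
(`PuncturedEllipticCoverings.lean`: the cusps `Cusp` of `X̲` with representative decomposition groups
`decomp x ⊆ Π_X̲ ⊆ Π_C`) towards abc-iut-L4-t1's interface `FundamentalExtension.CuspidalData`
([AbsTopIII] Prop. 1.4 (i) / Thm. 1.9 (a): a finite index set of cusps, closed decomposition groups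
`D_x ⊆ Π`, inertia `I_x = D_x ∩ Δ`, distinct cusps non-conjugate), ON the extension of `X̲`
`Π_X̲ ↠ aug(Π_X̲)` cut out of the core `Π_C ↠ G_k` by abc-iut-w5-d053's adapter A1
`FundamentalExtension.ofOpenSubgroup`:

* `PuncturedEllipticData.piXbarOpen` — `Π_X̲` as an open subgroup of `Π_C`; `extXbar` — the extension
  `1 → Δ_X̲ → Π_X̲ → aug(Π_X̲) → 1` (= `D.E.ofOpenSubgroup D.piXbarOpen`);
* `PuncturedEllipticData.CuspGalois.cuspidalDataXbar` — the cusps of `X̲` as `CuspidalData D.extXbar`,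
  the structure laws supplied by abc-iut-L5-t1's cusp interface `CuspGalois` (`isClosed_decomp`,
  `eq_of_conj`, `finite_cusp`);
* rfl / transport lemmas (`cuspidalDataXbar_Dcusp`, `map_subtype_cuspidalDataXbar_Dcusp`,
  `map_subtype_conj_smul_cuspidalDataXbar_Dcusp` — via abc-iut-L5-d4's `map_subtype_conj_smul_subgroupOf`).

Purpose: lets layer L4's typed [AbsTopI] Lem. 4.5 (v) (`CuspidalAlgorithm.RecoversCusps`, F-0206) be
consumed BY NAME at the `X̲`-extension (companion `PuncturedEllipticCoveringsCor12Lem45.lean`).  Nothing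
of the disputed series is asserted; no side is taken on [IUTchIII] Cor. 3.12.
-/

namespace Literature.IUT.HodgeTheaters

namespace PuncturedEllipticData

open scoped Pointwise
open Literature.AnabelianGeometry.AbsoluteAnabelian

universe u

variable (D : PuncturedEllipticData.{u})

/-! ### The extension of `X̲` -/

/-- `Π_X̲ ⊆ Π_C` as an OPEN subgroup (it is `Π_X ∩ Π_C̲`, both open). ([IUTchI] §1 p.37)
[claim: Mochizuki2012, status: disputed] -/
def piXbarOpen : OpenSubgroup D.PiC := ⟨D.PiXbar, D.isOpen_piX.inter D.isOpen_piCbar⟩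

/-- The underlying subgroup of `piXbarOpen` is `Π_X̲`. ([IUTchI] §1 p.37) [claim: Mochizuki2012, status:
disputed] -/
@[simp] theorem coe_piXbarOpen : (D.piXbarOpen : Subgroup D.PiC) = D.PiXbar := rfl

/-- The arithmetic fundamental extension of `X̲`: `1 → Δ_X̲ → Π_X̲ → aug(Π_X̲) → 1`, cut out of the core
`Π_C ↠ G_k` by the open subgroup `Π_X̲` (abc-iut-w5-d053's `FundamentalExtension.ofOpenSubgroup`; in
print `aug(Π_X̲) = G_k`, `X̲` being geometrically connected over `k`). ([IUTchI] §1 p.37)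
[claim: Mochizuki2012, status: disputed] -/
noncomputable abbrev extXbar : FundamentalExtension.{u} := D.E.ofOpenSubgroup D.piXbarOpen

/-- `Δ_X̲ = Δ_C ∩ Π_X̲` as the geometric part of the `X̲`-extension (a subgroup of `Π_X̲`).
([IUTchI] §1 p.37) [claim: Mochizuki2012, status: disputed] -/
theorem extXbar_geom : D.extXbar.geom = D.DeltaC.subgroupOf D.PiXbar :=
  D.E.geom_ofOpenSubgroup D.piXbarOpen

variable {D}

/-- Membership in `Δ_X̲` of the `X̲`-extension is membership in `Δ_C`. ([IUTchI] §1 p.37)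
[claim: Mochizuki2012, status: disputed] -/
theorem mem_extXbar_geom_iff (x : D.extXbar.arith) : x ∈ D.extXbar.geom ↔ x.1 ∈ D.DeltaC :=
  D.E.mem_geom_ofOpenSubgroup_iff D.piXbarOpen x

/-! ### The cusps of `X̲` as cuspidal data on the `X̲`-extension -/

namespace CuspGalois

variable (C : D.CuspGalois)

/-- **The cusps of `X̲` as cuspidal data** (abc-iut-L4-t1's `FundamentalExtension.CuspidalData`) on the
`X̲`-extension `Π_X̲ ↠ aug(Π_X̲)`: index set `Cusp(X̲)`, decomposition groups `D_x ⊆ Π_X̲` (the frozen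
representatives `decomp x`, which lie in `Π_X̲`), inertia `I_x = D_x ∩ Δ_X̲`; closedness and
non-conjugacy of distinct cusps and finiteness (`[Π_X : Π_X̲] < ∞`) from the cusp interface `CuspGalois`
(`isClosed_decomp`, `eq_of_conj`, `finite_cusp`). ([IUTchI] §1 p.37) [claim: Mochizuki2012, status: disputed] -/
noncomputable def cuspidalDataXbar : FundamentalExtension.CuspidalData D.extXbar where
  Cusp := D.Cusp
  finite := C.finite_cusp
  Dcusp x := (D.decomp x).subgroupOf D.PiXbar
  Icusp x := (D.decomp x).subgroupOf D.PiXbar ⊓ D.extXbar.geom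
  Icusp_eq _ := rfl
  isClosed_Dcusp x := (C.isClosed_decomp x).preimage continuous_subtype_val
  eq_of_conj x y g hg := by
    refine C.eq_of_conj x y g.1 g.2 ?_
    have h := congrArg (Subgroup.map D.PiXbar.subtype) hg
    have e1 := map_subtype_conj_smul_subgroupOf (C := D.PiXbar) g
      (show D.decomp x ≤ D.PiXbar from D.decomp_le x)
    have e2 : ((D.decomp y).subgroupOf D.PiXbar).map D.PiXbar.subtype = D.decomp y := by
      rw [Subgroup.subgroupOf_map_subtype, inf_eq_left.mpr (show D.decomp y ≤ D.PiXbar from D.decomp_le y)]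
    exact e1.symm.trans (h.trans e2)

/-- The index set of `cuspidalDataXbar` is `Cusp(X̲)`. ([IUTchI] §1 p.37) [claim: Mochizuki2012, status:
disputed] -/
theorem cuspidalDataXbar_Cusp : C.cuspidalDataXbar.Cusp = D.Cusp := rfl

/-- The decomposition groups of `cuspidalDataXbar` are the frozen representatives, viewed in `Π_X̲`.
([IUTchI] §1 p.37) [claim: Mochizuki2012, status: disputed] -/
theorem cuspidalDataXbar_Dcusp (x : D.Cusp) :
    C.cuspidalDataXbar.Dcusp x = (D.decomp x).subgroupOf D.PiXbar := rfl

/-- Pushed into `Π_C`, the decomposition group of `cuspidalDataXbar` at `x` is `decomp x`.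
([IUTchI] §1 p.37) [claim: Mochizuki2012, status: disputed] -/
theorem map_subtype_cuspidalDataXbar_Dcusp (x : D.Cusp) :
    (C.cuspidalDataXbar.Dcusp x).map D.PiXbar.subtype = D.decomp x := by
  rw [cuspidalDataXbar_Dcusp, Subgroup.subgroupOf_map_subtype,
    inf_eq_left.mpr (show D.decomp x ≤ D.PiXbar from D.decomp_le x)]

/-- Pushed into `Π_C`, a `Π_X̲`-conjugate of a decomposition group of `cuspidalDataXbar` is the
corresponding `Π_X̲`-conjugate of `decomp x`. ([IUTchI] §1 p.37) [claim: Mochizuki2012, status: disputed] -/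
theorem map_subtype_conj_smul_cuspidalDataXbar_Dcusp (g : D.extXbar.arith) (x : D.Cusp) :
    (MulAut.conj g • C.cuspidalDataXbar.Dcusp x).map D.PiXbar.subtype =
      MulAut.conj g.1 • D.decomp x :=
  map_subtype_conj_smul_subgroupOf g (show D.decomp x ≤ D.PiXbar from D.decomp_le x)

end CuspGalois

end PuncturedEllipticData

end Literature.IUT.HodgeTheaters
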